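import Mathlib
import Literature.Algebra.Polynomial.SelfReciprocalZerosCriterion
import Literature.Algebra.Polynomial.RealCubicRoots
import HarnessLib

/-!
# Suzuki's criterion for the zeros of real self-reciprocal polynomials: the printed `g = 3` row

A kernel-checked transcription AND PROOF of the `g = 3` row of the «small table» in

> M. Suzuki, *On zeros of self-reciprocal polynomials*, arXiv:1211.2953 (2012)
> [Suzuki2012SelfReciprocal]: §1 (def_Pg) `P₃(x) = c₀(x⁶+1) + c₁(x⁵+x) + c₂(x⁴+x²) + c₃x³`
> (real `c`, `c₀ ≠ 0`); §2.2 Theorem 2.6 (all zeros of `P_g` lie on `T = {|z| = 1}` and are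
> simple ⟺ `R_n(c) > 0` and `R_n(c)⁻¹ > 0` for every `1 ≤ n ≤ 2g`), the printed rational functions
> `R₂, …, R₆` for `g = 3` («calculated by hand according to the definition»), (rel_mR)
> `m_{2g−n}(c; log q) = R_{n−1}(c)R_n(c)/(g log q)` and Theorem 2.4 (the Hamiltonian form);
> §8 (1): the same `R_n` written in the zeros `2λ_j` of the Chebyshev transform,
> `P₃(x) = c₀ ∏ⱼ (x² − 2λⱼx + 1)`.

This file completes `Literature.Algebra.Polynomial.SelfReciprocalZerosCriterion` (the rows
`g = 1, 2`) with the last printed row: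

* `GenusThree.P` — (def_Pg) for `g = 3`; `GenusThree.R₂ … R₆` — the printed table, AS PRINTED;
  `GenusThree.m₅ … m₀` — the Hamiltonian entries via (rel_mR) with `L = log q`.
* **Theorem 2.6 for `g = 3` PROVED** (`GenusThree.onCircleSimple_iff`, `…_printed`) and
  Theorem 2.4 for `g = 3` in the `m`-form (`GenusThree.onCircleSimple_iff_m_pos`).
* §8 (1) for `g = 3`: the numerators / denominators of `R₂, …, R₆` as symmetric functions of the
  roots `y_j = 2λ_j` of the Joukowski (Chebyshev-transform) cubic `x⁻³P₃(x)` at `y = x + x⁻¹`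
  (`GenusThree.eR₂_roots`, …, `GenusThree.eR₆_roots`): they are the leading minors of the `2 × 2` Hermite forms
  `Σ_j w(y_j) L(y_j)²` with weights `w ∈ {1, 2−y, 2+y, 4−y²}`.

The proof is elementary and is NOT the source's (canonical systems, de Branges spaces): under
`y = x + x⁻¹`, «all six zeros on `T` and simple» becomes «the real cubic
`y³ − e₁y² + e₂y − e₃` has three distinct roots in `(−2, 2)`»; necessity of `R_n > 0` is termwise
positivity of the §8 (1) sums; sufficiency rests on ONE polynomial identity among the minors,
`2·eR₃den·eR₅num = eR₄num·eR₄den − disc·eR₃num` (the file-private `key_identity`), which forces the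
cubic discriminant to be positive once `R₂, …, R₅ > 0` (a complex-conjugate pair of roots would
give the two sides opposite signs), then on `Literature.Algebra.Polynomial.RealCubicRoots`
(`disc > 0` ⇒ three real roots) and on Sylvester's criterion for the `2 × 2` Hermite form with
weights `4 − y_j²` (`R₃, R₅, R₆ > 0` ⇒ every `4 − y_j² > 0`).

Honesty about the table. As in the `g ≤ 2` file, the source DEFINES `R_n` by the recursion
(def_m1)/(def_v1)/(def_R) of §2.1–2.2 and prints the `g = 3` row computed by hand; this file takes
the printed row as the definition. That the recursion and Suzuki's determinant formula
(J. Anal. Math. 136 (2018) = arXiv:1308.0228, Thm 1.1) reproduce this row is the cell's two-lineage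
exact computation of record (STEP-0 anchor P1, kits j240121 ‖ j240143: 1717/1717 agreements, rows
`g = 3, n = 2…6` «A ≡ B ≡ printed»), not a kernel fact; the kernel facts
`SelfReciprocalRecursion.GenusOne/GenusTwo.RRec_eq_table` cover `g ≤ 2` only. The CONTENT of the
row — Theorem 2.6 for `g = 3` — is proved here from scratch, which re-verifies the printed row
independently of either lineage (the equivalence `onCircleSimple_iff` is sensitive to the 60
printed monomials: e.g. it pins `R₄, R₅` to the Hermite minors of §8 (1), `eR₄_roots`/`eR₅_roots`).

Purpose (cell `run/shared/lean/pub/rh-dbr`, COLUMN 6 DBR, LADDER-RH B-D instrument custody): with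
this file every printed Hamiltonian datum of [Suzuki2012SelfReciprocal] (the table for `g = 1, 2, 3`
and Remark 3) is a kernel theorem. RH-FREE: finite facts about polynomials of degree `6`; nothing
here bears on the Riemann Hypothesis.

## Deliberately NOT here
The recursion (def_m1)/(def_v1)/(def_R) for `g = 3` (so no kernel proof that the RECURSION yields
this row — `SelfReciprocalRecursion` stops at `g ≤ 2`);
Theorems 2.7–2.9 (`q^ω` variants); §§3–7; a general-`g` statement (§8 (1) of the source asks for a
closed formula — the Hermite-minor pattern `R_{2k} = M_k(2−y)/M_k(2+y)`,
`R_{2k+1} ∝ M_k(4−y²)/M_{k+1}(1)` (`M_k(w)` = the `k × k` leading minor of `Σ_j w(y_j)L(y_j)²`)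
visible in this row is recorded in the docstrings only, not asserted for general `g`).

## References
* [Suzuki2012SelfReciprocal] M. Suzuki, On zeros of self-reciprocal polynomials, arXiv:1211.2953
  (2012): §1 (def_Pg); §2.2 Thm 2.4, (def_mg), (rel_mR), Thm 2.6 and the small table, row `g = 3`;
  §8 (1) (the `λ`-formulas for `g = 3`).
-/

noncomputable section

namespace Literature.Algebra.Polynomial

namespace SuzukiSelfReciprocal

open _root_.Polynomial _root_.Complex
open scoped ComplexConjugate

/-! ## Elementary lemmas (file-local copies of the private tools of the `g ≤ 2` file) -/

/-- Over `ℂ` every pair (sum, product) is realised: `∃ w w', w + w' = s ∧ w w' = p`. [folklore] -/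
private theorem exists_sum_prod_eq₃ (s p : ℂ) : ∃ w w' : ℂ, w + w' = s ∧ w * w' = p := by
  obtain ⟨d, hd⟩ := IsAlgClosed.exists_pow_nat_eq (s ^ 2 - 4 * p) (by norm_num : 0 < 2)
  refine ⟨(s + d) / 2, (s - d) / 2, by ring, ?_⟩
  have : (s + d) / 2 * ((s - d) / 2) = (s ^ 2 - d ^ 2) / 4 := by ring
  rw [this, hd]; ring

/-- `‖w‖ = 1 ⟺ (Re w)² + (Im w)² = 1`. [folklore] -/
private theorem norm_eq_one_iff_sq₃ (w : ℂ) : ‖w‖ = 1 ↔ w.re ^ 2 + w.im ^ 2 = 1 := by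
  have h0 : 0 ≤ ‖w‖ := norm_nonneg w
  constructor
  · intro h
    have : ‖w‖ ^ 2 = 1 := by rw [h]; norm_num
    rw [Complex.sq_norm, Complex.normSq_apply] at this
    nlinarith [this]
  · intro h
    have h2 : ‖w‖ ^ 2 = 1 := by
      rw [Complex.sq_norm, Complex.normSq_apply]; nlinarith [h]
    nlinarith [h2, h0]

/-- **Two-point lemma.** For `w w' = 1`: both unimodular and distinct iff `y = w + w'` is real with
`y² < 4`. [folklore] -/
private theorem pair_unimodular_iff₃ {w w' : ℂ} (h : w * w' = 1) :
    (‖w‖ = 1 ∧ ‖w'‖ = 1 ∧ w ≠ w') ↔ ((w + w').im = 0 ∧ (w + w').re ^ 2 < 4) := by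
  have hre : w.re * w'.re - w.im * w'.im = 1 := by
    have := congrArg Complex.re h; simpa [Complex.mul_re] using this
  have him : w.re * w'.im + w.im * w'.re = 0 := by
    have := congrArg Complex.im h; simpa [Complex.mul_im] using this
  rw [norm_eq_one_iff_sq₃, norm_eq_one_iff_sq₃, Ne, Complex.ext_iff, Complex.add_re, Complex.add_im]
  constructor
  · rintro ⟨h1, h2, h3⟩
    have ha : w'.re = w.re := by
      nlinarith [hre, him, h1, h2, sq_nonneg (w'.re - w.re), sq_nonneg (w'.im + w.im)]
    have hb : w'.im = -w.im := by
      nlinarith [hre, him, h1, h2, sq_nonneg (w'.re - w.re), sq_nonneg (w'.im + w.im)]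
    have hbne : w.im ≠ 0 := by
      intro hb0
      apply h3
      constructor
      · rw [ha]
      · rw [hb, hb0]; simp
    refine ⟨by rw [hb]; ring, ?_⟩
    rw [ha]
    have : 0 < w.im ^ 2 := by positivity
    nlinarith [h1, this]
  · rintro ⟨h1, h2⟩
    have hb : w'.im = -w.im := by linarith
    rw [hb] at hre him
    have hbne : w.im ≠ 0 := by
      intro hb0
      rw [hb0] at hre him hb
      simp at hre
      nlinarith [sq_nonneg (w.re - w'.re), hre, h2]
    have ha : w'.re = w.re := by
      have : w.im * (w'.re - w.re) = 0 := by linarith [him]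
      rcases mul_eq_zero.mp this with h3 | h3
      · exact absurd h3 hbne
      · linarith
    rw [ha] at hre h2
    refine ⟨by nlinarith [hre], by rw [ha, hb]; nlinarith [hre], ?_⟩
    intro ⟨_, h4⟩
    rw [hb] at h4
    apply hbne; linarith

/-- **Cross lemma.** Two pairs with product `1` are disjoint iff their sums differ. [folklore] -/
private theorem cross_ne_iff₃ {w₁ w₁' w₂ w₂' : ℂ} (h1 : w₁ * w₁' = 1) (h2 : w₂ * w₂' = 1) :
    (w₁ ≠ w₂ ∧ w₁ ≠ w₂' ∧ w₁' ≠ w₂ ∧ w₁' ≠ w₂') ↔ w₁ + w₁' ≠ w₂ + w₂' := by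
  constructor
  · rintro ⟨ha, _, hc, _⟩ hsum
    have key : (w₂ - w₁) * (w₂ - w₁') = 0 := by
      have : (w₂ - w₁) * (w₂ - w₁') = w₂ * w₂ - (w₁ + w₁') * w₂ + w₁ * w₁' := by ring
      rw [this, hsum, h1]; linear_combination (-1 : ℂ) * h2
    rcases mul_eq_zero.mp key with h | h
    · exact ha (sub_eq_zero.mp h).symm
    · exact hc (sub_eq_zero.mp h).symm
  · intro hne
    have inv1 : w₁' = w₁⁻¹ := eq_inv_of_mul_eq_one_right h1
    have inv1b : w₁ = w₁'⁻¹ := eq_inv_of_mul_eq_one_left h1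
    have inv2 : w₂' = w₂⁻¹ := eq_inv_of_mul_eq_one_right h2
    have inv2b : w₂ = w₂'⁻¹ := eq_inv_of_mul_eq_one_left h2
    refine ⟨?_, ?_, ?_, ?_⟩ <;> intro h <;> apply hne
    · rw [inv1, inv2, h]
    · rw [inv1, inv2b, h, add_comm]
    · rw [inv1b, inv2, h, add_comm]
    · rw [inv1b, inv2b, h]

/-! ## Sylvester's criterion for the `2 × 2` Hermite form of three real points -/

/-- Two negative weights `−u, −v` and one positive weight `w > u + v` make the `2 × 2` Hermite
minor negative: `uv(α+β)² − w(uα² + vβ²) < 0` for `α ≠ 0` — because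
`(u+v)(uα² + vβ²) − uv(α+β)² = (uα − vβ)²`. [folklore] -/
private theorem hermite_two_neg {u v w α β : ℝ} (hu : 0 < u) (hv : 0 < v) (hw : u + v < w)
    (hα : α ≠ 0) : u * v * (α + β) ^ 2 - w * (u * α ^ 2 + v * β ^ 2) < 0 := by
  have hα2 : 0 < α ^ 2 := by positivity
  have hpos : 0 < u * α ^ 2 + v * β ^ 2 := by
    nlinarith [mul_pos hu hα2, mul_nonneg hv.le (sq_nonneg β)]
  nlinarith [sq_nonneg (u * α - v * β), mul_lt_mul_of_pos_right hw hpos]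

/-- **Three-weights lemma** (Sylvester's criterion for `Σ_j w_j L(r_j)²`, `L` linear, three
distinct real nodes): if `Σ w_j > 0`, `Σ_{i<j} w_i w_j (r_i − r_j)² > 0` and `w₁w₂w₃ > 0`, then every
`w_j > 0`. [folklore] -/
private theorem weights_pos {w₁ w₂ w₃ r₁ r₂ r₃ : ℝ} (h12 : r₁ ≠ r₂) (h13 : r₁ ≠ r₃)
    (hsum : 0 < w₁ + w₂ + w₃)
    (hM : 0 < w₁ * w₂ * (r₁ - r₂) ^ 2 + w₁ * w₃ * (r₁ - r₃) ^ 2 + w₂ * w₃ * (r₂ - r₃) ^ 2)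
    (hprod : 0 < w₁ * w₂ * w₃) : 0 < w₁ ∧ 0 < w₂ ∧ 0 < w₃ := by
  have h1 : w₁ ≠ 0 := fun h => by rw [h] at hprod; simp at hprod
  have h2 : w₂ ≠ 0 := fun h => by rw [h] at hprod; simp at hprod
  have h3 : w₃ ≠ 0 := fun h => by rw [h] at hprod; simp at hprod
  -- the sign pattern (−, −, +) is impossible
  have key : ∀ {u v w a b c : ℝ}, u < 0 → v < 0 → 0 < u + v + w → a ≠ c →
      ¬ 0 < u * v * (a - b) ^ 2 + u * w * (a - c) ^ 2 + v * w * (b - c) ^ 2 := by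
    intro u v w a b c hu hv hs hac hM'
    have h := hermite_two_neg (u := -u) (v := -v) (w := w) (α := a - c) (β := c - b)
      (by linarith) (by linarith) (by linarith) (sub_ne_zero.mpr hac)
    have e : -u * -v * (a - c + (c - b)) ^ 2 - w * (-u * (a - c) ^ 2 + -v * (c - b) ^ 2) =
        u * v * (a - b) ^ 2 + u * w * (a - c) ^ 2 + v * w * (b - c) ^ 2 := by ring
    rw [e] at h
    exact absurd hM' (not_lt.mpr h.le)
  rcases h1.lt_or_gt with n1 | p1 <;> rcases h2.lt_or_gt with n2 | p2 <;>
    rcases h3.lt_or_gt with n3 | p3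
  · linarith
  · exact absurd hM (key n1 n2 hsum h13)
  · have hM' : 0 < w₁ * w₃ * (r₁ - r₃) ^ 2 + w₁ * w₂ * (r₁ - r₂) ^ 2 + w₃ * w₂ * (r₃ - r₂) ^ 2 := by
      have e : w₁ * w₃ * (r₁ - r₃) ^ 2 + w₁ * w₂ * (r₁ - r₂) ^ 2 + w₃ * w₂ * (r₃ - r₂) ^ 2 =
          w₁ * w₂ * (r₁ - r₂) ^ 2 + w₁ * w₃ * (r₁ - r₃) ^ 2 + w₂ * w₃ * (r₂ - r₃) ^ 2 := by ring
      rw [e]; exact hM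
    exact absurd hM' (key n1 n3 (by linarith) h12)
  · nlinarith [mul_neg_of_neg_of_pos n1 (mul_pos p2 p3)]
  · have hM' : 0 < w₂ * w₃ * (r₂ - r₃) ^ 2 + w₂ * w₁ * (r₂ - r₁) ^ 2 + w₃ * w₁ * (r₃ - r₁) ^ 2 := by
      have e : w₂ * w₃ * (r₂ - r₃) ^ 2 + w₂ * w₁ * (r₂ - r₁) ^ 2 + w₃ * w₁ * (r₃ - r₁) ^ 2 =
          w₁ * w₂ * (r₁ - r₂) ^ 2 + w₁ * w₃ * (r₁ - r₃) ^ 2 + w₂ * w₃ * (r₂ - r₃) ^ 2 := by ring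
      rw [e]; exact hM
    exact absurd hM' (key n2 n3 (by linarith) h12.symm)
  · nlinarith [mul_neg_of_neg_of_pos n2 (mul_pos p1 p3)]
  · nlinarith [mul_neg_of_neg_of_pos n3 (mul_pos p1 p2)]
  · exact ⟨p1, p2, p3⟩

/-! ## Genus three: `P₃(x) = c₀(x⁶+1) + c₁(x⁵+x) + c₂(x⁴+x²) + c₃x³` -/

namespace GenusThree

/-- (def_Pg) for `g = 3`: `P₃(x) = c₀x⁶ + c₁x⁵ + c₂x⁴ + c₃x³ + c₂x² + c₁x + c₀` (real `c`), as a
complex polynomial. [cite: Suzuki2012SelfReciprocal, §1 (def_Pg), g = 3] -/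
def P (c₀ c₁ c₂ c₃ : ℝ) : ℂ[X] :=
  C (c₀ : ℂ) * X ^ 6 + C (c₁ : ℂ) * X ^ 5 + C (c₂ : ℂ) * X ^ 4 + C (c₃ : ℂ) * X ^ 3 +
    C (c₂ : ℂ) * X ^ 2 + C (c₁ : ℂ) * X + C (c₀ : ℂ)

/-- The printed table, `g = 3`: `R₂ = (6c₀ + c₁)/(6c₀ − c₁)`.
[cite: Suzuki2012SelfReciprocal, §2.2, table after Thm 2.6, g = 3] -/
def R₂ (c₀ c₁ _c₂ _c₃ : ℝ) : ℝ := (6 * c₀ + c₁) / (6 * c₀ - c₁)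

/-- The printed table, `g = 3`: `R₃ = (18c₀² − 3c₁² + 6c₀c₂)/(18c₀² + 2c₁² − 6c₀c₂)`.
[cite: Suzuki2012SelfReciprocal, §2.2, table after Thm 2.6, g = 3] -/
def R₃ (c₀ c₁ c₂ _c₃ : ℝ) : ℝ :=
  (18 * c₀ ^ 2 - 3 * c₁ ^ 2 + 6 * c₀ * c₂) / (18 * c₀ ^ 2 + 2 * c₁ ^ 2 - 6 * c₀ * c₂)

/-- The printed NUMERATOR of `R₄`, `g = 3`: `36c₀³ + 6c₀²c₁ − c₀c₁² + 4c₁³ − 14c₀c₁c₂ + c₁²c₂ − 4c₀c₂²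
+ 18c₀²c₃ + 3c₀c₁c₃`, monomials in the printed order. [cite: Suzuki2012SelfReciprocal, §2.2, table after Thm 2.6, g = 3] -/
def R₄num (c₀ c₁ c₂ c₃ : ℝ) : ℝ :=
  36 * c₀ ^ 3 + 6 * c₀ ^ 2 * c₁ - c₀ * c₁ ^ 2 + 4 * c₁ ^ 3 - 14 * c₀ * c₁ * c₂ + c₁ ^ 2 * c₂ -
    4 * c₀ * c₂ ^ 2 + 18 * c₀ ^ 2 * c₃ + 3 * c₀ * c₁ * c₃

/-- The printed DENOMINATOR of `R₄`, `g = 3`: `36c₀³ − 6c₀²c₁ − c₀c₁² − 4c₁³ + 14c₀c₁c₂ + c₁²c₂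
− 4c₀c₂² − 18c₀²c₃ + 3c₀c₁c₃`. [cite: Suzuki2012SelfReciprocal, §2.2, table after Thm 2.6, g = 3] -/
def R₄den (c₀ c₁ c₂ c₃ : ℝ) : ℝ :=
  36 * c₀ ^ 3 - 6 * c₀ ^ 2 * c₁ - c₀ * c₁ ^ 2 - 4 * c₁ ^ 3 + 14 * c₀ * c₁ * c₂ + c₁ ^ 2 * c₂ -
    4 * c₀ * c₂ ^ 2 - 18 * c₀ ^ 2 * c₃ + 3 * c₀ * c₁ * c₃

/-- The printed table, `g = 3`: `R₄ = R₄num/R₄den`. [cite: Suzuki2012SelfReciprocal, §2.2, table after Thm 2.6, g = 3] -/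
def R₄ (c₀ c₁ c₂ c₃ : ℝ) : ℝ := R₄num c₀ c₁ c₂ c₃ / R₄den c₀ c₁ c₂ c₃

/-- The printed NUMERATOR of `R₅`, `g = 3`: `108c₀⁴ − 21c₀²c₁² − 12c₁⁴ + 108c₀³c₂ + 42c₀c₁²c₂
− 12c₀²c₂² + 3c₁²c₂² − 12c₀c₂³ − 54c₀²c₁c₃ − 6c₁³c₃ + 30c₀c₁c₂c₃ − 27c₀²c₃²`, monomials in the
printed order. [cite: Suzuki2012SelfReciprocal, §2.2, table after Thm 2.6, g = 3] -/
def R₅num (c₀ c₁ c₂ c₃ : ℝ) : ℝ :=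
  108 * c₀ ^ 4 - 21 * c₀ ^ 2 * c₁ ^ 2 - 12 * c₁ ^ 4 + 108 * c₀ ^ 3 * c₂ + 42 * c₀ * c₁ ^ 2 * c₂ -
    12 * c₀ ^ 2 * c₂ ^ 2 + 3 * c₁ ^ 2 * c₂ ^ 2 - 12 * c₀ * c₂ ^ 3 - 54 * c₀ ^ 2 * c₁ * c₃ -
    6 * c₁ ^ 3 * c₃ + 30 * c₀ * c₁ * c₂ * c₃ - 27 * c₀ ^ 2 * c₃ ^ 2

/-- The printed DENOMINATOR of `R₅`, `g = 3`: `108c₀⁴ + 9c₀²c₁² + 8c₁⁴ − 108c₀³c₂ − 42c₀c₁²c₂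
+ 36c₀²c₂² + c₁²c₂² − 4c₀c₂³ + 54c₀²c₁c₃ − 4c₁³c₃ + 18c₀c₁c₂c₃ − 27c₀²c₃²`.
[cite: Suzuki2012SelfReciprocal, §2.2, table after Thm 2.6, g = 3] -/
def R₅den (c₀ c₁ c₂ c₃ : ℝ) : ℝ :=
  108 * c₀ ^ 4 + 9 * c₀ ^ 2 * c₁ ^ 2 + 8 * c₁ ^ 4 - 108 * c₀ ^ 3 * c₂ - 42 * c₀ * c₁ ^ 2 * c₂ +
    36 * c₀ ^ 2 * c₂ ^ 2 + c₁ ^ 2 * c₂ ^ 2 - 4 * c₀ * c₂ ^ 3 + 54 * c₀ ^ 2 * c₁ * c₃ -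
    4 * c₁ ^ 3 * c₃ + 18 * c₀ * c₁ * c₂ * c₃ - 27 * c₀ ^ 2 * c₃ ^ 2

/-- The printed table, `g = 3`: `R₅ = R₅num/R₅den`. [cite: Suzuki2012SelfReciprocal, §2.2, table after Thm 2.6, g = 3] -/
def R₅ (c₀ c₁ c₂ c₃ : ℝ) : ℝ := R₅num c₀ c₁ c₂ c₃ / R₅den c₀ c₁ c₂ c₃

/-- The printed table, `g = 3`: `R₆ = (2c₀ + 2c₁ + 2c₂ + c₃)/(2c₀ − 2c₁ + 2c₂ − c₃)`.
[cite: Suzuki2012SelfReciprocal, §2.2, table after Thm 2.6, g = 3] -/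
def R₆ (c₀ c₁ c₂ c₃ : ℝ) : ℝ := (2 * c₀ + 2 * c₁ + 2 * c₂ + c₃) / (2 * c₀ - 2 * c₁ + 2 * c₂ - c₃)

/-- (rel_mR), `g = 3`, `n = 1`, `L = log q`: `m₅(c; L) = R₀R₁/(3L) = 1/(3L)` ((def_mg):
`m_{2g} = 1/(g log q)`). [cite: Suzuki2012SelfReciprocal, §2.2 (rel_mR), (def_mg)] -/
def m₅ (_c₀ _c₁ _c₂ _c₃ L : ℝ) : ℝ := 1 * 1 / (3 * L)

/-- (rel_mR), `g = 3`, `n = 2`: `m₄ = R₁R₂/(3L)`. [cite: Suzuki2012SelfReciprocal, §2.2 (rel_mR)] -/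
def m₄ (c₀ c₁ c₂ c₃ L : ℝ) : ℝ := 1 * R₂ c₀ c₁ c₂ c₃ / (3 * L)

/-- (rel_mR), `g = 3`, `n = 3`: `m₃ = R₂R₃/(3L)`. [cite: Suzuki2012SelfReciprocal, §2.2 (rel_mR)] -/
def m₃ (c₀ c₁ c₂ c₃ L : ℝ) : ℝ := R₂ c₀ c₁ c₂ c₃ * R₃ c₀ c₁ c₂ c₃ / (3 * L)

/-- (rel_mR), `g = 3`, `n = 4`: `m₂ = R₃R₄/(3L)`. [cite: Suzuki2012SelfReciprocal, §2.2 (rel_mR)] -/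
def m₂ (c₀ c₁ c₂ c₃ L : ℝ) : ℝ := R₃ c₀ c₁ c₂ c₃ * R₄ c₀ c₁ c₂ c₃ / (3 * L)

/-- (rel_mR), `g = 3`, `n = 5`: `m₁ = R₄R₅/(3L)`. [cite: Suzuki2012SelfReciprocal, §2.2 (rel_mR)] -/
def m₁ (c₀ c₁ c₂ c₃ L : ℝ) : ℝ := R₄ c₀ c₁ c₂ c₃ * R₅ c₀ c₁ c₂ c₃ / (3 * L)

/-- (rel_mR), `g = 3`, `n = 6`: `m₀ = R₅R₆/(3L)`. [cite: Suzuki2012SelfReciprocal, §2.2 (rel_mR)] -/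
def m₀ (c₀ c₁ c₂ c₃ L : ℝ) : ℝ := R₅ c₀ c₁ c₂ c₃ * R₆ c₀ c₁ c₂ c₃ / (3 * L)

/-! ### The table in the coefficients `e` of the Joukowski cubic

Under `y = x + x⁻¹`, `x⁻³P₃(x) = c₀y³ + c₁y² + (c₂ − 3c₀)y + (c₃ − 2c₁) = c₀(y³ − e₁y² + e₂y − e₃)`
with `c₁ = −c₀e₁`, `c₂ = c₀(e₂ + 3)`, `c₃ = −c₀(2e₁ + e₃)`; the `e_k` are the elementary symmetric
functions of the roots `y₁, y₂, y₃ = 2λ₁, 2λ₂, 2λ₃` (§8 (1)). The printed `R_n` become the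
following quotients (`R₂_subst` … `R₆_subst`). -/

/-- The monic real cubic `y³ − e₁y² + e₂y − e₃` (as a `Cubic ℝ`): for `c = (c₀, −c₀e₁, c₀(e₂+3),
−c₀(2e₁+e₃))` it is `c₀⁻¹x⁻³P₃(x)` at `y = x + x⁻¹`, whose roots are the `2λ_j` of §8 (1)
(`P₃(x) = c₀∏(x² − 2λ_jx + 1)`). [cite: Suzuki2012SelfReciprocal, §8 (1)] -/
def jCubic (e₁ e₂ e₃ : ℝ) : Cubic ℝ := ⟨1, -e₁, e₂, -e₃⟩

/-- `R₂`'s numerator in `e`: `6 − e₁` (`= Σ_j (2 − y_j)`). [cite: Suzuki2012SelfReciprocal, §8 (1), g = 3, R₂] -/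
def eR₂num (e₁ _e₂ _e₃ : ℝ) : ℝ := 6 - e₁

/-- `R₂`'s denominator in `e`: `6 + e₁` (`= Σ_j (2 + y_j)`). [cite: Suzuki2012SelfReciprocal, §8 (1), g = 3, R₂] -/
def eR₂den (e₁ _e₂ _e₃ : ℝ) : ℝ := 6 + e₁

/-- `R₃`'s numerator in `e` (up to the factor `3`): `12 + 2e₂ − e₁²` (`= Σ_j (4 − y_j²)`).
[cite: Suzuki2012SelfReciprocal, §8 (1), g = 3, R₃] -/
def eR₃num (e₁ e₂ _e₃ : ℝ) : ℝ := 12 + 2 * e₂ - e₁ ^ 2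

/-- `R₃`'s denominator in `e` (up to the factor `2`): `e₁² − 3e₂` (`= ½ Σ_{i<j} (y_i − y_j)²`).
[cite: Suzuki2012SelfReciprocal, §8 (1), g = 3, R₃] -/
def eR₃den (e₁ e₂ _e₃ : ℝ) : ℝ := e₁ ^ 2 - 3 * e₂

/-- `R₄`'s numerator in `e`: `−4e₁³ + e₁²e₂ + 8e₁² + 14e₁e₂ + 3e₁e₃ − 4e₂² − 24e₂ − 18e₃`
(`= Σ_{i<j} (2 − y_i)(2 − y_j)(y_i − y_j)²`). [cite: Suzuki2012SelfReciprocal, §8 (1), g = 3, R₄] -/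
def eR₄num (e₁ e₂ e₃ : ℝ) : ℝ :=
  -4 * e₁ ^ 3 + e₁ ^ 2 * e₂ + 8 * e₁ ^ 2 + 14 * e₁ * e₂ + 3 * e₁ * e₃ - 4 * e₂ ^ 2 - 24 * e₂ - 18 * e₃

/-- `R₄`'s denominator in `e`: `4e₁³ + e₁²e₂ + 8e₁² − 14e₁e₂ + 3e₁e₃ − 4e₂² − 24e₂ + 18e₃`
(`= Σ_{i<j} (2 + y_i)(2 + y_j)(y_i − y_j)²`). [cite: Suzuki2012SelfReciprocal, §8 (1), g = 3, R₄] -/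
def eR₄den (e₁ e₂ e₃ : ℝ) : ℝ :=
  4 * e₁ ^ 3 + e₁ ^ 2 * e₂ + 8 * e₁ ^ 2 - 14 * e₁ * e₂ + 3 * e₁ * e₃ - 4 * e₂ ^ 2 - 24 * e₂ + 18 * e₃

/-- `R₅`'s numerator in `e` (up to the factor `3`): `−8e₁⁴ − 2e₁³e₃ + e₁²e₂² + 40e₁²e₂ + 32e₁²
+ 10e₁e₂e₃ − 24e₁e₃ − 4e₂³ − 40e₂² − 96e₂ − 9e₃²` (`= Σ_{i<j} (4 − y_i²)(4 − y_j²)(y_i − y_j)²`).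
[cite: Suzuki2012SelfReciprocal, §8 (1), g = 3, R₅] -/
def eR₅num (e₁ e₂ e₃ : ℝ) : ℝ :=
  -8 * e₁ ^ 4 - 2 * e₁ ^ 3 * e₃ + e₁ ^ 2 * e₂ ^ 2 + 40 * e₁ ^ 2 * e₂ + 32 * e₁ ^ 2 +
    10 * e₁ * e₂ * e₃ - 24 * e₁ * e₃ - 4 * e₂ ^ 3 - 40 * e₂ ^ 2 - 96 * e₂ - 9 * e₃ ^ 2

/-- `R₅`'s denominator in `e`: the discriminant of the cubic `y³ − e₁y² + e₂y − e₃`,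
`−4e₁³e₃ + e₁²e₂² + 18e₁e₂e₃ − 4e₂³ − 27e₃²` (`= ∏_{i<j} (y_i − y_j)²`).
[cite: Suzuki2012SelfReciprocal, §8 (1), g = 3, R₅] -/
def disc (e₁ e₂ e₃ : ℝ) : ℝ :=
  -4 * e₁ ^ 3 * e₃ + e₁ ^ 2 * e₂ ^ 2 + 18 * e₁ * e₂ * e₃ - 4 * e₂ ^ 3 - 27 * e₃ ^ 2

/-- `R₆`'s numerator in `e`: `8 − 4e₁ + 2e₂ − e₃` (`= ∏_j (2 − y_j)`). [cite: Suzuki2012SelfReciprocal, §8 (1), g = 3, R₆] -/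
def eR₆num (e₁ e₂ e₃ : ℝ) : ℝ := 8 - 4 * e₁ + 2 * e₂ - e₃

/-- `R₆`'s denominator in `e`: `8 + 4e₁ + 2e₂ + e₃` (`= ∏_j (2 + y_j)`). [cite: Suzuki2012SelfReciprocal, §8 (1), g = 3, R₆] -/
def eR₆den (e₁ e₂ e₃ : ℝ) : ℝ := 8 + 4 * e₁ + 2 * e₂ + e₃

/-- The printed `R₂` at `c = (c₀, −c₀e₁, c₀(e₂+3), −c₀(2e₁+e₃))`: `(6 − e₁)/(6 + e₁)`. [cite: Suzuki2012SelfReciprocal, §2.2 table, g = 3, in Joukowski coordinates] -/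
theorem R₂_subst {c₀ : ℝ} (e₁ e₂ e₃ : ℝ) (h₀ : c₀ ≠ 0) :
    R₂ c₀ (-(c₀ * e₁)) (c₀ * (e₂ + 3)) (-(c₀ * (2 * e₁ + e₃))) = eR₂num e₁ e₂ e₃ / eR₂den e₁ e₂ e₃ := by
  unfold R₂ eR₂num eR₂den
  rw [show 6 * c₀ + -(c₀ * e₁) = c₀ * (6 - e₁) by ring,
    show 6 * c₀ - -(c₀ * e₁) = c₀ * (6 + e₁) by ring]
  exact mul_div_mul_left _ _ h₀

/-- The printed `R₃` in Joukowski coordinates: `3(12 + 2e₂ − e₁²)/(2(e₁² − 3e₂))`. [cite: Suzuki2012SelfReciprocal, §2.2 table, g = 3, in Joukowski coordinates] -/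
theorem R₃_subst {c₀ : ℝ} (e₁ e₂ e₃ : ℝ) (h₀ : c₀ ≠ 0) :
    R₃ c₀ (-(c₀ * e₁)) (c₀ * (e₂ + 3)) (-(c₀ * (2 * e₁ + e₃))) =
      3 * eR₃num e₁ e₂ e₃ / (2 * eR₃den e₁ e₂ e₃) := by
  unfold R₃ eR₃num eR₃den
  have h2 : c₀ ^ 2 ≠ 0 := pow_ne_zero 2 h₀
  rw [show 18 * c₀ ^ 2 - 3 * (-(c₀ * e₁)) ^ 2 + 6 * c₀ * (c₀ * (e₂ + 3))
        = c₀ ^ 2 * (3 * (12 + 2 * e₂ - e₁ ^ 2)) by ring,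
    show 18 * c₀ ^ 2 + 2 * (-(c₀ * e₁)) ^ 2 - 6 * c₀ * (c₀ * (e₂ + 3))
        = c₀ ^ 2 * (2 * (e₁ ^ 2 - 3 * e₂)) by ring]
  exact mul_div_mul_left _ _ h2

/-- The printed `R₄` in Joukowski coordinates: `eR₄num/eR₄den`. [cite: Suzuki2012SelfReciprocal, §2.2 table, g = 3, in Joukowski coordinates] -/
theorem R₄_subst {c₀ : ℝ} (e₁ e₂ e₃ : ℝ) (h₀ : c₀ ≠ 0) :
    R₄ c₀ (-(c₀ * e₁)) (c₀ * (e₂ + 3)) (-(c₀ * (2 * e₁ + e₃))) = eR₄num e₁ e₂ e₃ / eR₄den e₁ e₂ e₃ := by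
  unfold R₄
  rw [show R₄num c₀ (-(c₀ * e₁)) (c₀ * (e₂ + 3)) (-(c₀ * (2 * e₁ + e₃))) = c₀ ^ 3 * eR₄num e₁ e₂ e₃ by
      simp only [R₄num, eR₄num]; ring,
    show R₄den c₀ (-(c₀ * e₁)) (c₀ * (e₂ + 3)) (-(c₀ * (2 * e₁ + e₃))) = c₀ ^ 3 * eR₄den e₁ e₂ e₃ by
      simp only [R₄den, eR₄den]; ring]
  exact mul_div_mul_left _ _ (pow_ne_zero 3 h₀)

/-- The printed `R₅` in Joukowski coordinates: `3·eR₅num/disc`. [cite: Suzuki2012SelfReciprocal, §2.2 table, g = 3, in Joukowski coordinates] -/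
theorem R₅_subst {c₀ : ℝ} (e₁ e₂ e₃ : ℝ) (h₀ : c₀ ≠ 0) :
    R₅ c₀ (-(c₀ * e₁)) (c₀ * (e₂ + 3)) (-(c₀ * (2 * e₁ + e₃))) =
      3 * eR₅num e₁ e₂ e₃ / disc e₁ e₂ e₃ := by
  unfold R₅
  rw [show R₅num c₀ (-(c₀ * e₁)) (c₀ * (e₂ + 3)) (-(c₀ * (2 * e₁ + e₃))) =
        c₀ ^ 4 * (3 * eR₅num e₁ e₂ e₃) by simp only [R₅num, eR₅num]; ring,
    show R₅den c₀ (-(c₀ * e₁)) (c₀ * (e₂ + 3)) (-(c₀ * (2 * e₁ + e₃))) = c₀ ^ 4 * disc e₁ e₂ e₃ by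
      simp only [R₅den, disc]; ring]
  exact mul_div_mul_left _ _ (pow_ne_zero 4 h₀)

/-- The printed `R₆` in Joukowski coordinates: `(8 − 4e₁ + 2e₂ − e₃)/(8 + 4e₁ + 2e₂ + e₃)`. [cite: Suzuki2012SelfReciprocal, §2.2 table, g = 3, in Joukowski coordinates] -/
theorem R₆_subst {c₀ : ℝ} (e₁ e₂ e₃ : ℝ) (h₀ : c₀ ≠ 0) :
    R₆ c₀ (-(c₀ * e₁)) (c₀ * (e₂ + 3)) (-(c₀ * (2 * e₁ + e₃))) = eR₆num e₁ e₂ e₃ / eR₆den e₁ e₂ e₃ := by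
  unfold R₆ eR₆num eR₆den
  rw [show 2 * c₀ + 2 * -(c₀ * e₁) + 2 * (c₀ * (e₂ + 3)) + -(c₀ * (2 * e₁ + e₃))
        = c₀ * (8 - 4 * e₁ + 2 * e₂ - e₃) by ring,
    show 2 * c₀ - 2 * -(c₀ * e₁) + 2 * (c₀ * (e₂ + 3)) - -(c₀ * (2 * e₁ + e₃))
        = c₀ * (8 + 4 * e₁ + 2 * e₂ + e₃) by ring]
  exact mul_div_mul_left _ _ h₀

/-! ### §8 (1): the table in the roots `y_j = 2λ_j` — Hermite-form minors -/

/-- §8 (1), `g = 3`, `R₂`: `6 − e₁ = Σ(2 − y_j)` and `6 + e₁ = Σ(2 + y_j)` (the source's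
`R₂ = Σ(1−λ_j)/Σ(1+λ_j)`, `y = 2λ`). [cite: Suzuki2012SelfReciprocal, §8 (1), g = 3, R₂] -/
theorem eR₂_roots (r₁ r₂ r₃ : ℝ) :
    eR₂num (r₁ + r₂ + r₃) (r₁ * r₂ + r₁ * r₃ + r₂ * r₃) (r₁ * r₂ * r₃) =
        (2 - r₁) + (2 - r₂) + (2 - r₃) ∧
      eR₂den (r₁ + r₂ + r₃) (r₁ * r₂ + r₁ * r₃ + r₂ * r₃) (r₁ * r₂ * r₃) =
        (2 + r₁) + (2 + r₂) + (2 + r₃) := by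
  constructor <;> simp only [eR₂num, eR₂den] <;> ring

/-- §8 (1), `g = 3`, `R₃`: `12 + 2e₂ − e₁² = Σ(4 − y_j²)` (the minor `M₁(4−y²)`) and
`2(e₁² − 3e₂) = Σ_{i<j}(y_i − y_j)²` (the minor `M₂(1)`) — the source's
`R₃ = 3Σ(1−λ_j²)/Σ_{i<j}(λ_i−λ_j)²`. [cite: Suzuki2012SelfReciprocal, §8 (1), g = 3, R₃] -/
theorem eR₃_roots (r₁ r₂ r₃ : ℝ) :
    eR₃num (r₁ + r₂ + r₃) (r₁ * r₂ + r₁ * r₃ + r₂ * r₃) (r₁ * r₂ * r₃) =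
        (4 - r₁ ^ 2) + (4 - r₂ ^ 2) + (4 - r₃ ^ 2) ∧
      2 * eR₃den (r₁ + r₂ + r₃) (r₁ * r₂ + r₁ * r₃ + r₂ * r₃) (r₁ * r₂ * r₃) =
        (r₁ - r₂) ^ 2 + (r₁ - r₃) ^ 2 + (r₂ - r₃) ^ 2 := by
  constructor <;> simp only [eR₃num, eR₃den] <;> ring

/-- §8 (1), `g = 3`, `R₄`: numerator `Σ_{i<j}(2−y_i)(2−y_j)(y_i−y_j)²`, denominator
`Σ_{i<j}(2+y_i)(2+y_j)(y_i−y_j)²` (the minors `M₂(2∓y)`; the source's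
`R₄ = Σ(1−λ_i)(1−λ_j)(λ_i−λ_j)²/Σ(1+λ_i)(1+λ_j)(λ_i−λ_j)²`). [cite: Suzuki2012SelfReciprocal, §8 (1), g = 3, R₄] -/
theorem eR₄_roots (r₁ r₂ r₃ : ℝ) :
    eR₄num (r₁ + r₂ + r₃) (r₁ * r₂ + r₁ * r₃ + r₂ * r₃) (r₁ * r₂ * r₃) =
        (2 - r₁) * (2 - r₂) * (r₁ - r₂) ^ 2 + (2 - r₁) * (2 - r₃) * (r₁ - r₃) ^ 2 +
          (2 - r₂) * (2 - r₃) * (r₂ - r₃) ^ 2 ∧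
      eR₄den (r₁ + r₂ + r₃) (r₁ * r₂ + r₁ * r₃ + r₂ * r₃) (r₁ * r₂ * r₃) =
        (2 + r₁) * (2 + r₂) * (r₁ - r₂) ^ 2 + (2 + r₁) * (2 + r₃) * (r₁ - r₃) ^ 2 +
          (2 + r₂) * (2 + r₃) * (r₂ - r₃) ^ 2 := by
  constructor <;> simp only [eR₄num, eR₄den] <;> ring

/-- §8 (1), `g = 3`, `R₅`: numerator `Σ_{i<j}(4−y_i²)(4−y_j²)(y_i−y_j)²` (the minor `M₂(4−y²)`),
denominator `∏_{i<j}(y_i−y_j)²` (the discriminant, `M₃(1)`) — the source's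
`R₅ = 3Σ(1−λ_i²)(1−λ_j²)(λ_i−λ_j)²/∏(λ_i−λ_j)²`. [cite: Suzuki2012SelfReciprocal, §8 (1), g = 3, R₅] -/
theorem eR₅_roots (r₁ r₂ r₃ : ℝ) :
    eR₅num (r₁ + r₂ + r₃) (r₁ * r₂ + r₁ * r₃ + r₂ * r₃) (r₁ * r₂ * r₃) =
        (4 - r₁ ^ 2) * (4 - r₂ ^ 2) * (r₁ - r₂) ^ 2 + (4 - r₁ ^ 2) * (4 - r₃ ^ 2) * (r₁ - r₃) ^ 2 +
          (4 - r₂ ^ 2) * (4 - r₃ ^ 2) * (r₂ - r₃) ^ 2 ∧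
      disc (r₁ + r₂ + r₃) (r₁ * r₂ + r₁ * r₃ + r₂ * r₃) (r₁ * r₂ * r₃) =
        ((r₁ - r₂) * (r₁ - r₃) * (r₂ - r₃)) ^ 2 := by
  constructor <;> simp only [eR₅num, disc] <;> ring

/-- §8 (1), `g = 3`, `R₆`: `8 − 4e₁ + 2e₂ − e₃ = ∏(2 − y_j)`, `8 + 4e₁ + 2e₂ + e₃ = ∏(2 + y_j)` (the
source's `R₆ = ∏(1−λ_j)/∏(1+λ_j)`). [cite: Suzuki2012SelfReciprocal, §8 (1), g = 3, R₆] -/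
theorem eR₆_roots (r₁ r₂ r₃ : ℝ) :
    eR₆num (r₁ + r₂ + r₃) (r₁ * r₂ + r₁ * r₃ + r₂ * r₃) (r₁ * r₂ * r₃) =
        (2 - r₁) * (2 - r₂) * (2 - r₃) ∧
      eR₆den (r₁ + r₂ + r₃) (r₁ * r₂ + r₁ * r₃ + r₂ * r₃) (r₁ * r₂ * r₃) =
        (2 + r₁) * (2 + r₂) * (2 + r₃) := by
  constructor <;> simp only [eR₆num, eR₆den] <;> ring

/-- **The key identity** among the Hermite-form minors of three points:
`M₂(1)·M₂(4−y²) = M₂(2−y)·M₂(2+y) − M₃(1)·M₁(4−y²)`, i.e. in `e`: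
`2·eR₃den·eR₅num = eR₄num·eR₄den − disc·eR₃num` (a Sylvester-type determinant identity; it holds
for arbitrary `e`, checked by `ring`). It is what makes Theorem 2.6 (`g = 3`) elementary: with a
complex-conjugate pair of roots (`disc < 0`) the conditions `R₃, R₄, R₅ > 0` give the two sides
opposite signs. [folklore] -/
private theorem key_identity (e₁ e₂ e₃ : ℝ) :
    2 * eR₃den e₁ e₂ e₃ * eR₅num e₁ e₂ e₃ =
      eR₄num e₁ e₂ e₃ * eR₄den e₁ e₂ e₃ - disc e₁ e₂ e₃ * eR₃num e₁ e₂ e₃ := by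
  simp only [eR₃den, eR₅num, eR₄num, eR₄den, disc, eR₃num]; ring

/-- Mathlib's `Cubic.discr` of `y³ − e₁y² + e₂y − e₃` is `disc e₁ e₂ e₃`. [folklore] -/
private theorem jCubic_discr (e₁ e₂ e₃ : ℝ) : (jCubic e₁ e₂ e₃).discr = disc e₁ e₂ e₃ := by
  simp only [Cubic.discr, jCubic, disc]; ring

/-! ### The core: three distinct roots in `(−2, 2)` ⟺ the five quotients are positive -/

/-- Vieta for the complex roots of `jCubic e₁ e₂ e₃`. [folklore] -/
private theorem jCubic_vieta {e₁ e₂ e₃ : ℝ} {y₁ y₂ y₃ : ℂ}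
    (h3 : (Cubic.map ofRealHom (jCubic e₁ e₂ e₃)).roots = {y₁, y₂, y₃}) :
    (e₁ : ℂ) = y₁ + y₂ + y₃ ∧ (e₂ : ℂ) = y₁ * y₂ + y₁ * y₃ + y₂ * y₃ ∧ (e₃ : ℂ) = y₁ * y₂ * y₃ := by
  have ha : (jCubic e₁ e₂ e₃).a ≠ 0 := by simp [jCubic]
  have hb := Cubic.b_eq_three_roots (φ := ofRealHom) ha h3
  have hc := Cubic.c_eq_three_roots (φ := ofRealHom) ha h3
  have hd := Cubic.d_eq_three_roots (φ := ofRealHom) ha h3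
  simp only [jCubic, ofRealHom_eq_coe, ofReal_neg, ofReal_one, one_mul] at hb hc hd
  refine ⟨?_, hc, ?_⟩
  · linear_combination (-1 : ℂ) * hb
  · linear_combination (-1 : ℂ) * hd

/-- **The real-algebra core of Theorem 2.6 for `g = 3`.** For the three complex roots
`y₁, y₂, y₃` of the real cubic `y³ − e₁y² + e₂y − e₃`: all three are real, lie in `(−2, 2)` and are
distinct ⟺ the five quotients `(6−e₁)/(6+e₁)`, `3·eR₃num/(2·eR₃den)`, `eR₄num/eR₄den`,
`3·eR₅num/disc`, `eR₆num/eR₆den` (the printed `R₂, …, R₆` in Joukowski coordinates) are positive.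
(⇒): termwise positivity of the §8 (1) sums. (⇐): `R₂, R₃ > 0` give `Σ(4−y_j²) > 0` and
`Σ(y_i−y_j)² > 0`; by `key_identity`, `R₄, R₅ > 0` then force `disc > 0`, so the roots are real
(`Literature.Algebra.Polynomial.roots_real_or_conj_pair`, `discr_neg_of_conj_pair`) and distinct;
finally `weights_pos` with weights `4 − y_j²` (`R₃, R₅, R₆`). [cite: Suzuki2012SelfReciprocal, Thm 2.6, case g = 3; elementary proof in Joukowski coordinates] -/
theorem realTriple_iff {e₁ e₂ e₃ : ℝ} {y₁ y₂ y₃ : ℂ}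
    (h3 : (Cubic.map ofRealHom (jCubic e₁ e₂ e₃)).roots = {y₁, y₂, y₃}) :
    ((y₁.im = 0 ∧ y₁.re ^ 2 < 4) ∧ (y₂.im = 0 ∧ y₂.re ^ 2 < 4) ∧ (y₃.im = 0 ∧ y₃.re ^ 2 < 4) ∧
        y₁ ≠ y₂ ∧ y₁ ≠ y₃ ∧ y₂ ≠ y₃) ↔
      (0 < eR₂num e₁ e₂ e₃ / eR₂den e₁ e₂ e₃ ∧
        0 < 3 * eR₃num e₁ e₂ e₃ / (2 * eR₃den e₁ e₂ e₃) ∧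
        0 < eR₄num e₁ e₂ e₃ / eR₄den e₁ e₂ e₃ ∧
        0 < 3 * eR₅num e₁ e₂ e₃ / disc e₁ e₂ e₃ ∧
        0 < eR₆num e₁ e₂ e₃ / eR₆den e₁ e₂ e₃) := by
  have ha : (jCubic e₁ e₂ e₃).a ≠ 0 := by simp [jCubic]
  obtain ⟨he₁, he₂, he₃⟩ := jCubic_vieta h3
  constructor
  · -- (⇒): the roots are real numbers `r_j ∈ (−2, 2)`, distinct
    rintro ⟨⟨h1i, h1r⟩, ⟨h2i, h2r⟩, ⟨h3i, h3r⟩, h12, h13, h23⟩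
    obtain ⟨r₁, rfl⟩ : ∃ r : ℝ, y₁ = (r : ℂ) := ⟨y₁.re, Complex.ext (by simp) (by simp [h1i])⟩
    obtain ⟨r₂, rfl⟩ : ∃ r : ℝ, y₂ = (r : ℂ) := ⟨y₂.re, Complex.ext (by simp) (by simp [h2i])⟩
    obtain ⟨r₃, rfl⟩ : ∃ r : ℝ, y₃ = (r : ℂ) := ⟨y₃.re, Complex.ext (by simp) (by simp [h3i])⟩
    simp only [ofReal_re] at h1r h2r h3r
    have hE₁ : e₁ = r₁ + r₂ + r₃ := by exact_mod_cast he₁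
    have hE₂ : e₂ = r₁ * r₂ + r₁ * r₃ + r₂ * r₃ := by exact_mod_cast he₂
    have hE₃ : e₃ = r₁ * r₂ * r₃ := by exact_mod_cast he₃
    have h12' : r₁ ≠ r₂ := fun h => h12 (by rw [h])
    have h13' : r₁ ≠ r₃ := fun h => h13 (by rw [h])
    have h23' : r₂ ≠ r₃ := fun h => h23 (by rw [h])
    subst hE₁ hE₂ hE₃
    rw [(eR₂_roots r₁ r₂ r₃).1, (eR₂_roots r₁ r₂ r₃).2, (eR₃_roots r₁ r₂ r₃).1,
      show 2 * eR₃den (r₁ + r₂ + r₃) (r₁ * r₂ + r₁ * r₃ + r₂ * r₃) (r₁ * r₂ * r₃) =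
        (r₁ - r₂) ^ 2 + (r₁ - r₃) ^ 2 + (r₂ - r₃) ^ 2 from (eR₃_roots r₁ r₂ r₃).2,
      (eR₄_roots r₁ r₂ r₃).1, (eR₄_roots r₁ r₂ r₃).2, (eR₅_roots r₁ r₂ r₃).1,
      (eR₅_roots r₁ r₂ r₃).2, (eR₆_roots r₁ r₂ r₃).1, (eR₆_roots r₁ r₂ r₃).2]
    have a1 : 0 < 2 - r₁ := by nlinarith
    have a2 : 0 < 2 - r₂ := by nlinarith
    have a3 : 0 < 2 - r₃ := by nlinarith
    have b1 : 0 < 2 + r₁ := by nlinarith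
    have b2 : 0 < 2 + r₂ := by nlinarith
    have b3 : 0 < 2 + r₃ := by nlinarith
    have w1 : 0 < 4 - r₁ ^ 2 := by linarith
    have w2 : 0 < 4 - r₂ ^ 2 := by linarith
    have w3 : 0 < 4 - r₃ ^ 2 := by linarith
    have d12 : 0 < (r₁ - r₂) ^ 2 := by have := sub_ne_zero.mpr h12'; positivity
    have d13 : 0 < (r₁ - r₃) ^ 2 := by have := sub_ne_zero.mpr h13'; positivity
    have d23 : 0 < (r₂ - r₃) ^ 2 := by have := sub_ne_zero.mpr h23'; positivity
    refine ⟨div_pos (by linarith) (by linarith), div_pos (by linarith) (by linarith),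
      div_pos ?_ ?_, div_pos ?_ (by positivity), div_pos ?_ ?_⟩
    · have := mul_pos (mul_pos a1 a2) d12
      have := mul_pos (mul_pos a1 a3) d13
      have := mul_pos (mul_pos a2 a3) d23
      linarith
    · have := mul_pos (mul_pos b1 b2) d12
      have := mul_pos (mul_pos b1 b3) d13
      have := mul_pos (mul_pos b2 b3) d23
      linarith
    · have := mul_pos (mul_pos w1 w2) d12
      have := mul_pos (mul_pos w1 w3) d13
      have := mul_pos (mul_pos w2 w3) d23
      linarith
    · exact mul_pos (mul_pos a1 a2) a3
    · exact mul_pos (mul_pos b1 b2) b3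
  · -- (⇐)
    rintro ⟨hR2, hR3, hR4, hR5, hR6⟩
    -- Step A: `R₂ > 0` ⟹ `|e₁| < 6`; with `R₃ > 0` ⟹ `eR₃num > 0` and `eR₃den > 0`
    simp only [eR₂num, eR₂den] at hR2
    rw [div_pos_iff] at hR2 hR3 hR4 hR5 hR6
    have hE : -6 < e₁ ∧ e₁ < 6 := by
      rcases hR2 with ⟨h1, h2⟩ | ⟨h1, h2⟩
      · exact ⟨by linarith, by linarith⟩
      · exfalso; linarith
    have hA : 0 < eR₃num e₁ e₂ e₃ ∧ 0 < eR₃den e₁ e₂ e₃ := by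
      rcases hR3 with ⟨h1, h2⟩ | ⟨h1, h2⟩
      · exact ⟨by linarith, by linarith⟩
      · exfalso
        have : 3 * eR₃num e₁ e₂ e₃ + 2 * eR₃den e₁ e₂ e₃ = 36 - e₁ ^ 2 := by
          simp only [eR₃num, eR₃den]; ring
        nlinarith [hE.1, hE.2]
    obtain ⟨hAn, hAd⟩ := hA
    -- Step B: `R₄ > 0`, `R₅ > 0` and the key identity force `disc > 0`
    have h44 : 0 < eR₄num e₁ e₂ e₃ * eR₄den e₁ e₂ e₃ := by
      rcases hR4 with ⟨h1, h2⟩ | ⟨h1, h2⟩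
      · exact mul_pos h1 h2
      · exact mul_pos_of_neg_of_neg h1 h2
    have key := key_identity e₁ e₂ e₃
    have hDN : 0 < disc e₁ e₂ e₃ ∧ 0 < eR₅num e₁ e₂ e₃ := by
      rcases hR5 with ⟨h1, h2⟩ | ⟨h1, h2⟩
      · exact ⟨h2, by linarith⟩
      · exfalso
        have hn : eR₅num e₁ e₂ e₃ < 0 := by linarith
        have h5 : 2 * eR₃den e₁ e₂ e₃ * eR₅num e₁ e₂ e₃ < 0 := by
          nlinarith [mul_pos_of_neg_of_neg hn hn]
        have h6 : disc e₁ e₂ e₃ * eR₃num e₁ e₂ e₃ < 0 := mul_neg_of_neg_of_pos h2 hAn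
        linarith
    obtain ⟨hD, hN5⟩ := hDN
    -- Step C: `disc > 0` ⟹ the three roots are distinct and real
    have hD' : 0 < (jCubic e₁ e₂ e₃).discr := by rw [jCubic_discr]; exact hD
    obtain ⟨h12, h13, h23⟩ := (Cubic.discr_ne_zero_iff_roots_ne (φ := ofRealHom) ha h3).mp hD'.ne'
    have hreal : conj y₁ = y₁ ∧ conj y₂ = y₂ ∧ conj y₃ = y₃ := by
      rcases roots_real_or_conj_pair ha h3 h12 h13 h23 with h | ⟨t, u, ht, hu, h3'⟩
      · exact h
      · exact absurd hD' (not_lt.mpr (discr_neg_of_conj_pair ha h3' ht hu).le)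
    obtain ⟨hc1, hc2, hc3⟩ := hreal
    obtain ⟨r₁, rfl⟩ : ∃ r : ℝ, y₁ = (r : ℂ) := ⟨y₁.re, (conj_eq_iff_re.mp hc1).symm⟩
    obtain ⟨r₂, rfl⟩ : ∃ r : ℝ, y₂ = (r : ℂ) := ⟨y₂.re, (conj_eq_iff_re.mp hc2).symm⟩
    obtain ⟨r₃, rfl⟩ : ∃ r : ℝ, y₃ = (r : ℂ) := ⟨y₃.re, (conj_eq_iff_re.mp hc3).symm⟩
    have hE₁ : e₁ = r₁ + r₂ + r₃ := by exact_mod_cast he₁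
    have hE₂ : e₂ = r₁ * r₂ + r₁ * r₃ + r₂ * r₃ := by exact_mod_cast he₂
    have hE₃ : e₃ = r₁ * r₂ * r₃ := by exact_mod_cast he₃
    have h12' : r₁ ≠ r₂ := fun h => h12 (by rw [h])
    have h13' : r₁ ≠ r₃ := fun h => h13 (by rw [h])
    subst hE₁ hE₂ hE₃
    rw [(eR₃_roots r₁ r₂ r₃).1] at hAn
    rw [(eR₅_roots r₁ r₂ r₃).1] at hN5
    rw [(eR₆_roots r₁ r₂ r₃).1, (eR₆_roots r₁ r₂ r₃).2] at hR6
    -- Step D: Sylvester for the weights `4 − r_j²`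
    have hprod : 0 < (4 - r₁ ^ 2) * (4 - r₂ ^ 2) * (4 - r₃ ^ 2) := by
      have e : (4 - r₁ ^ 2) * (4 - r₂ ^ 2) * (4 - r₃ ^ 2) =
          ((2 - r₁) * (2 - r₂) * (2 - r₃)) * ((2 + r₁) * (2 + r₂) * (2 + r₃)) := by ring
      rw [e]
      rcases hR6 with ⟨h1, h2⟩ | ⟨h1, h2⟩
      · exact mul_pos h1 h2
      · exact mul_pos_of_neg_of_neg h1 h2
    have hw := weights_pos h12' h13' hAn hN5 hprod
    simp only [ofReal_im, ofReal_re, true_and]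
    exact ⟨by linarith [hw.1], by linarith [hw.2.1], by linarith [hw.2.2], h12, h13, h23⟩

/-! ### The roots of `P₃` -/

/-- `P₃ = c₀ ∏_j (X − w_j)(X − w_j')` whenever `e_k` are the symmetric functions of `y₁, y₂, y₃`,
`c = (c₀, −c₀e₁, c₀(e₂+3), −c₀(2e₁+e₃))`, and `w_j + w_j' = y_j`, `w_jw_j' = 1` (the factorisation
`P₃(x) = c₀∏(x² − y_jx + 1)` of §8 (1), `y_j = 2λ_j`). [cite: Suzuki2012SelfReciprocal, §8 (1)] -/
theorem P_eq_prod {c₀ e₁ e₂ e₃ : ℝ} {y₁ y₂ y₃ w₁ w₁' w₂ w₂' w₃ w₃' : ℂ}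
    (he₁ : (e₁ : ℂ) = y₁ + y₂ + y₃) (he₂ : (e₂ : ℂ) = y₁ * y₂ + y₁ * y₃ + y₂ * y₃)
    (he₃ : (e₃ : ℂ) = y₁ * y₂ * y₃)
    (h1 : w₁ + w₁' = y₁) (h1' : w₁ * w₁' = 1) (h2 : w₂ + w₂' = y₂) (h2' : w₂ * w₂' = 1)
    (h3 : w₃ + w₃' = y₃) (h3' : w₃ * w₃' = 1) :
    P c₀ (-(c₀ * e₁)) (c₀ * (e₂ + 3)) (-(c₀ * (2 * e₁ + e₃))) =
      C (c₀ : ℂ) * ((X - C w₁) * (X - C w₁') * ((X - C w₂) * (X - C w₂')) *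
        ((X - C w₃) * (X - C w₃'))) := by
  have q : ∀ w w' : ℂ, (X - C w) * (X - C w') = X ^ 2 - C (w + w') * X + C (w * w') := by
    intro w w'; simp only [map_add, map_mul]; ring
  rw [q, q, q, h1, h1', h2, h2', h3, h3', P]
  push_cast
  rw [he₁, he₂, he₃]
  simp only [map_add, map_mul, map_neg, map_one, map_ofNat]
  ring

/-- `P₃ ≠ 0` when `c₀ ≠ 0`. [cite: Suzuki2012SelfReciprocal, §1 (def_Pg), g = 3] -/
theorem P_ne_zero {c₀ : ℝ} (c₁ c₂ c₃ : ℝ) (h₀ : c₀ ≠ 0) : P c₀ c₁ c₂ c₃ ≠ 0 := by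
  intro h
  have := congrArg (fun Q : ℂ[X] => Q.coeff 0) h
  simp [P] at this
  exact h₀ (by exact_mod_cast this)

/-- The root multiset of `P₃`: `{w₁, w₁', w₂, w₂', w₃, w₃'}` in the notation of `P_eq_prod`. [folklore] -/
private theorem P_roots {c₀ e₁ e₂ e₃ : ℝ} {y₁ y₂ y₃ w₁ w₁' w₂ w₂' w₃ w₃' : ℂ} (h₀ : c₀ ≠ 0)
    (he₁ : (e₁ : ℂ) = y₁ + y₂ + y₃) (he₂ : (e₂ : ℂ) = y₁ * y₂ + y₁ * y₃ + y₂ * y₃)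
    (he₃ : (e₃ : ℂ) = y₁ * y₂ * y₃)
    (h1 : w₁ + w₁' = y₁) (h1' : w₁ * w₁' = 1) (h2 : w₂ + w₂' = y₂) (h2' : w₂ * w₂' = 1)
    (h3 : w₃ + w₃' = y₃) (h3' : w₃ * w₃' = 1) :
    (P c₀ (-(c₀ * e₁)) (c₀ * (e₂ + 3)) (-(c₀ * (2 * e₁ + e₃)))).roots =
      {w₁, w₁', w₂, w₂', w₃, w₃'} := by
  rw [P_eq_prod he₁ he₂ he₃ h1 h1' h2 h2' h3 h3', roots_C_mul _ (by exact_mod_cast h₀)]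
  have e : ((X - C w₁) * (X - C w₁') * ((X - C w₂) * (X - C w₂')) * ((X - C w₃) * (X - C w₃'))
      : ℂ[X]) = (({w₁, w₁', w₂, w₂', w₃, w₃'} : Multiset ℂ).map fun w => X - C w).prod := by
    simp only [Multiset.insert_eq_cons, Multiset.map_cons, Multiset.map_singleton,
      Multiset.prod_cons, Multiset.prod_singleton]
    ring
  rw [e, roots_multiset_prod_X_sub_C]

/-- Combinatorial step for three Vieta pairs: «no repetition and all unimodular» ⟺ each pair-sum
`y_j = w_j + w_j'` is real with `y_j² < 4`, and the `y_j` are pairwise distinct. [folklore] -/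
private theorem nodup_unimodular_iff {w₁ w₁' w₂ w₂' w₃ w₃' : ℂ} (h1' : w₁ * w₁' = 1) (h2' : w₂ * w₂' = 1)
    (h3' : w₃ * w₃' = 1) :
    (({w₁, w₁', w₂, w₂', w₃, w₃'} : Multiset ℂ).Nodup ∧
        ∀ z ∈ ({w₁, w₁', w₂, w₂', w₃, w₃'} : Multiset ℂ), ‖z‖ = 1) ↔
      (((w₁ + w₁').im = 0 ∧ (w₁ + w₁').re ^ 2 < 4) ∧ ((w₂ + w₂').im = 0 ∧ (w₂ + w₂').re ^ 2 < 4) ∧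
        ((w₃ + w₃').im = 0 ∧ (w₃ + w₃').re ^ 2 < 4) ∧
        w₁ + w₁' ≠ w₂ + w₂' ∧ w₁ + w₁' ≠ w₃ + w₃' ∧ w₂ + w₂' ≠ w₃ + w₃') := by
  rw [← pair_unimodular_iff₃ h1', ← pair_unimodular_iff₃ h2', ← pair_unimodular_iff₃ h3',
    ← cross_ne_iff₃ h1' h2', ← cross_ne_iff₃ h1' h3', ← cross_ne_iff₃ h2' h3']
  simp only [Multiset.insert_eq_cons, Multiset.nodup_cons, Multiset.mem_cons,
    Multiset.mem_singleton, Multiset.nodup_singleton, and_true, forall_eq_or_imp, forall_eq, not_or]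
  tauto

/-! ### Theorem 2.6 and Theorem 2.4 for `g = 3` -/

/-- **Theorem 2.6 for `g = 3`.** For real `c₀ ≠ 0`, `c₁`, `c₂`, `c₃`: all zeros of
`P₃(x) = c₀(x⁶+1) + c₁(x⁵+x) + c₂(x⁴+x²) + c₃x³` lie on `T` and are simple ⟺ `R_n > 0` for
`n = 2, …, 6` with the printed `R₂, …, R₆` (the printed condition «`R_n > 0` and `R_n⁻¹ > 0`,
`1 ≤ n ≤ 6» — `R₁ = 1`, and `R⁻¹ > 0 ⟺ R > 0`; a vanishing denominator makes the quotient `0` in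
Lean, matching the source's «finite positive» reading). [cite: Suzuki2012SelfReciprocal, Thm 2.6, case g = 3; elementary proof here via y = x + 1/x and Hermite forms] -/
theorem onCircleSimple_iff {c₀ : ℝ} (c₁ c₂ c₃ : ℝ) (h₀ : c₀ ≠ 0) :
    OnCircleSimple (P c₀ c₁ c₂ c₃) ↔
      0 < R₂ c₀ c₁ c₂ c₃ ∧ 0 < R₃ c₀ c₁ c₂ c₃ ∧ 0 < R₄ c₀ c₁ c₂ c₃ ∧ 0 < R₅ c₀ c₁ c₂ c₃ ∧
        0 < R₆ c₀ c₁ c₂ c₃ := by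
  -- Joukowski coordinates: `c₁ = −c₀e₁`, `c₂ = c₀(e₂+3)`, `c₃ = −c₀(2e₁+e₃)`
  obtain ⟨e₁, rfl⟩ : ∃ e₁ : ℝ, c₁ = -(c₀ * e₁) := ⟨-c₁ / c₀, by field_simp⟩
  obtain ⟨e₂, rfl⟩ : ∃ e₂ : ℝ, c₂ = c₀ * (e₂ + 3) := ⟨c₂ / c₀ - 3, by field_simp; ring⟩
  obtain ⟨e₃, rfl⟩ : ∃ e₃ : ℝ, c₃ = -(c₀ * (2 * e₁ + e₃)) :=
    ⟨-c₃ / c₀ - 2 * e₁, by field_simp; ring⟩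
  -- the three roots of the Joukowski cubic and their Vieta pairs
  have ha : (jCubic e₁ e₂ e₃).a ≠ 0 := by simp [jCubic]
  obtain ⟨y₁, y₂, y₃, h3⟩ := (Cubic.splits_iff_roots_eq_three (φ := ofRealHom) ha).mp
    (IsAlgClosed.splits _)
  obtain ⟨he₁, he₂, he₃⟩ := jCubic_vieta h3
  obtain ⟨w₁, w₁', hw1, hw1'⟩ := exists_sum_prod_eq₃ y₁ 1
  obtain ⟨w₂, w₂', hw2, hw2'⟩ := exists_sum_prod_eq₃ y₂ 1
  obtain ⟨w₃, w₃', hw3, hw3'⟩ := exists_sum_prod_eq₃ y₃ 1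
  rw [R₂_subst e₁ e₂ e₃ h₀, R₃_subst e₁ e₂ e₃ h₀, R₄_subst e₁ e₂ e₃ h₀, R₅_subst e₁ e₂ e₃ h₀,
    R₆_subst e₁ e₂ e₃ h₀, OnCircleSimple, P_roots h₀ he₁ he₂ he₃ hw1 hw1' hw2 hw2' hw3 hw3',
    nodup_unimodular_iff hw1' hw2' hw3', hw1, hw2, hw3]
  exact realTriple_iff h3

/-- The printed form of Theorem 2.6 (`g = 3`): «`R_n(c) > 0` and `R_n(c)⁻¹ > 0` for every
`1 ≤ n ≤ 6`» with `R₁ = 1`. [cite: Suzuki2012SelfReciprocal, Thm 2.6, case g = 3, as printed] -/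
theorem onCircleSimple_iff_printed {c₀ : ℝ} (c₁ c₂ c₃ : ℝ) (h₀ : c₀ ≠ 0) :
    OnCircleSimple (P c₀ c₁ c₂ c₃) ↔
      ((0 : ℝ) < 1 ∧ (0 : ℝ) < 1⁻¹) ∧ (0 < R₂ c₀ c₁ c₂ c₃ ∧ 0 < (R₂ c₀ c₁ c₂ c₃)⁻¹) ∧
        (0 < R₃ c₀ c₁ c₂ c₃ ∧ 0 < (R₃ c₀ c₁ c₂ c₃)⁻¹) ∧ (0 < R₄ c₀ c₁ c₂ c₃ ∧ 0 < (R₄ c₀ c₁ c₂ c₃)⁻¹) ∧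
        (0 < R₅ c₀ c₁ c₂ c₃ ∧ 0 < (R₅ c₀ c₁ c₂ c₃)⁻¹) ∧ (0 < R₆ c₀ c₁ c₂ c₃ ∧ 0 < (R₆ c₀ c₁ c₂ c₃)⁻¹) := by
  rw [onCircleSimple_iff c₁ c₂ c₃ h₀]
  simp only [inv_pos, and_self, inv_one, zero_lt_one, true_and]

/-- **Theorem 2.4 for `g = 3`** (the Hamiltonian form): for `q > 1` (`L = log q > 0`), all zeros of
`P₃` lie on `T` and are simple ⟺ `m_{2g−n}(c; log q) > 0` for `n = 1, …, 6`, with the `m`'s given by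
(rel_mR) from the printed table (`R₀ = R₁ = 1 > 0` and consecutive `R`'s share signs).
[cite: Suzuki2012SelfReciprocal, Thm 2.4, case g = 3, with (rel_mR)] -/
theorem onCircleSimple_iff_m_pos {c₀ : ℝ} (c₁ c₂ c₃ : ℝ) (h₀ : c₀ ≠ 0) {L : ℝ} (hL : 0 < L) :
    OnCircleSimple (P c₀ c₁ c₂ c₃) ↔
      0 < m₅ c₀ c₁ c₂ c₃ L ∧ 0 < m₄ c₀ c₁ c₂ c₃ L ∧ 0 < m₃ c₀ c₁ c₂ c₃ L ∧ 0 < m₂ c₀ c₁ c₂ c₃ L ∧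
        0 < m₁ c₀ c₁ c₂ c₃ L ∧ 0 < m₀ c₀ c₁ c₂ c₃ L := by
  rw [onCircleSimple_iff c₁ c₂ c₃ h₀]
  have h3L : 0 < 3 * L := by linarith
  simp only [m₅, m₄, m₃, m₂, m₁, m₀, one_mul, div_pos_iff_of_pos_right h3L, zero_lt_one, true_and]
  constructor
  · rintro ⟨h2, h3, h4, h5, h6⟩
    exact ⟨h2, mul_pos h2 h3, mul_pos h3 h4, mul_pos h4 h5, mul_pos h5 h6⟩
  · rintro ⟨h2, h23, h34, h45, h56⟩
    have h3 : 0 < R₃ c₀ c₁ c₂ c₃ := (mul_pos_iff_of_pos_left h2).mp h23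
    have h4 : 0 < R₄ c₀ c₁ c₂ c₃ := (mul_pos_iff_of_pos_left h3).mp h34
    have h5 : 0 < R₅ c₀ c₁ c₂ c₃ := (mul_pos_iff_of_pos_left h4).mp h45
    exact ⟨h2, h3, h4, h5, (mul_pos_iff_of_pos_left h5).mp h56⟩

/-- A control example for `g = 3` (ours, in the spirit of the source's Remark 3):
`P₃(x) = x⁶ − x⁴ − x² + 1 = (x²−1)²(x²+1)` has all its zeros on `T` but `±1` are double zeros; here
`c = (1, 0, −1, 0)`, the Joukowski cubic is `y³ − 4y = y(y−2)(y+2)` and the printed table gives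
`R₂ = 1`, `R₃ = 1/2`, `R₄ = 1`, `R₅ = 0` (`= 0/256`), `R₆ = 0` (`= 0/0` in Lean) — `R₅, R₆` are
not positive. [folklore] -/
private theorem R_example :
    R₂ 1 0 (-1) 0 = 1 ∧ R₃ 1 0 (-1) 0 = 1 / 2 ∧ R₄ 1 0 (-1) 0 = 1 ∧ R₅ 1 0 (-1) 0 = 0 ∧
      R₆ 1 0 (-1) 0 = 0 := by
  refine ⟨?_, ?_, ?_, ?_, ?_⟩ <;> norm_num [R₂, R₃, R₄, R₄num, R₄den, R₅, R₅num, R₅den, R₆]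

/-- The control example is caught by Theorem 2.6: NOT all zeros of `x⁶ − x⁴ − x² + 1` are simple
zeros on `T` (`R₅ = 0` is not positive). [folklore] -/
private theorem not_onCircleSimple_example : ¬ OnCircleSimple (P 1 0 (-1) 0) := by
  rw [onCircleSimple_iff 0 (-1) 0 (by norm_num : (1 : ℝ) ≠ 0), R_example.2.2.2.1]
  simp

end GenusThree

end SuzukiSelfReciprocal

end Literature.Algebra.Polynomial
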